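import Literature.NumberTheory.GaloisCohomology.BrauerSumInvCyclicClass
import HarnessLib

/-!
# The cyclic reciprocity law `∑_v inv_v (κ(b) ∪ ψ) = 0` for characters of odd order

The sum formula `sum_localInvariantMap_localization_cupProduct_δ₀_eq_zero` (Tate, Cassels–Fröhlich
VII §10) carries an archimedean hypothesis `hinf`: the Artin map `ψ_{L|K}` kills the archimedean idèle
of `b`.  For a totally complex field this is automatic (`…_of_isTotallyComplex`).  Here we discharge it
for an ARBITRARY number field `K` when `Gal(L/K)` has ODD order — in particular for the cyclic
characters `ψ : Γ_K ↠ ℤ/p^e` with `p` odd of Tate's proof of the reciprocity law on `H²(Γ_K, μ_{p^m})`: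

* `sq_mem_connectedComponent_one_units_infiniteAdeleRing` — every square of `K_∞ˣ = ∏_{w ∣ ∞} K_wˣ`
  lies in the identity component (at a real place `K_wˣ ≅ ℝˣ ⊃ ℝ_{>0} ∋ z²`, at a complex place
  `K_wˣ ≅ ℂˣ` is connected);
* `artinIdeleMap_infiniteIdeles_eq_one_of_odd_card` — hence `ψ_{L|K}` of an archimedean idèle is
  `2`-torsion (the identity component lies in every norm group), so it is trivial when `#Gal(L/K)` is odd;
* `card_gal_eq_of_ker_eq_galFixing` — `#Gal(L/K) = d` when `ker ψ = Gal(K̄/L)` for `ψ : Γ_K ↠ ℤ/d`;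
* `sum_localInvariantMap_localization_cupProduct_δ₀_eq_zero_of_odd` — the sum formula for `ψ` of odd
  level `d`, any number field `K`.

## References

* J. Tate, *Global class field theory*, Ch. VII of Cassels–Fröhlich (1967), §10. [CasselsFrohlichANT1967]
* J. Neukirch, *Algebraic Number Theory* (1999), Ch. VI §5 (5.6)–(5.8) (archimedean components). [NeukirchANT1999]
-/

noncomputable section

open CategoryTheory Function NumberField IsDedekindDomain Field ValuativeRel
open scoped NumberField

namespace Literature.NumberTheory.GaloisCohomology

open _root_.ContinuousCohomology
open Literature.NumberTheory.GaloisRepresentations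
open Literature.NumberTheory.GaloisRepresentations.DiscreteGaloisModule
open Literature.NumberTheory.GaloisRepresentations.LocalWeilDatum
open Literature.NumberTheory.GaloisRepresentations.IsNonarchimedeanLocalField
open Literature.NumberTheory.NumberFields
open Literature.AnabelianGeometry.AbsoluteAnabelian
open Literature.AnabelianGeometry.AbsoluteAnabelian.Prop121vii

variable {K : Type} [Field K] [NumberField K]

/-! ### §1. Squares of `K_∞ˣ` lie in the identity component -/

omit [NumberField K] in
/-- At an infinite place `w`, every square of `K_wˣ` lies in the connected component of `1`:
`K_wˣ ≅ ℂˣ` is connected at a complex place, and at a real place `K_w ≅ ℝ` and `z² > 0` lies in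
the connected set `ℝ_{>0} ∋ 1`. [cite: NeukirchANT1999, Ch. VI §5 Prop. (5.6)] -/
theorem sq_mem_connectedComponent_one_units_completion (w : InfinitePlace K) (z : (w.Completion)ˣ) :
    z ^ 2 ∈ connectedComponent (1 : (w.Completion)ˣ) := by
  rcases w.isReal_or_isComplex with hw | hw
  · -- real place: the positive elements form a connected set containing `1` and `z ^ 2`
    let e : w.Completion ≃+* ℝ := InfinitePlace.Completion.ringEquivRealOfIsReal hw
    have he_cont : Continuous e.symm :=
      (InfinitePlace.Completion.isometryEquivRealOfIsReal hw).symm.continuous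
    have hne : ∀ t : {t : ℝ // 0 < t}, e.symm (t : ℝ) ≠ 0 := fun t h => by
      have := congrArg e h
      rw [e.apply_symm_apply, map_zero] at this
      exact t.2.ne' this
    let g : {t : ℝ // 0 < t} → (w.Completion)ˣ := fun t => Units.mk0 (e.symm (t : ℝ)) (hne t)
    have hg : Continuous g := by
      rw [Units.continuous_iff]
      refine ⟨he_cont.comp continuous_subtype_val, ?_⟩
      have h1 : (fun t : {t : ℝ // 0 < t} => ((g t)⁻¹ : (w.Completion)ˣ).val) =
          fun t : {t : ℝ // 0 < t} => e.symm ((t.1)⁻¹) := by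
        funext t
        rw [Units.val_inv_eq_inv_val, Units.val_mk0, map_inv₀]
      rw [h1]
      exact he_cont.comp ((continuous_subtype_val.inv₀ fun t : {t : ℝ // 0 < t} => t.2.ne'))
    haveI : PreconnectedSpace {t : ℝ // 0 < t} := Subtype.preconnectedSpace isPreconnected_Ioi
    have hrange : IsPreconnected (Set.range g) := isPreconnected_range hg
    have h1 : (1 : (w.Completion)ˣ) ∈ Set.range g :=
      ⟨⟨1, one_pos⟩, Units.ext (by simp [g])⟩
    have hez : e (z : w.Completion) ≠ 0 := fun h => z.ne_zero (by
      have := congrArg e.symm h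
      rwa [e.symm_apply_apply, map_zero] at this)
    have hz : z ^ 2 ∈ Set.range g := by
      refine ⟨⟨(e (z : w.Completion)) ^ 2, even_two.pow_pos hez⟩, Units.ext ?_⟩
      change (Units.mk0 _ _ : (w.Completion)ˣ).val = ((z ^ 2 : (w.Completion)ˣ) : w.Completion)
      rw [Units.val_mk0, Units.val_pow_eq_pow_val, map_pow, e.symm_apply_apply]
    exact (hrange.subset_connectedComponent h1) hz
  · haveI := connectedSpace_units_completion_of_isComplex hw
    rw [PreconnectedSpace.connectedComponent_eq_univ]
    exact Set.mem_univ _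

omit [NumberField K] in
/-- **Every square of `K_∞ˣ = ∏_{w ∣ ∞} K_wˣ` lies in the identity component** (`K_∞ˣ ≅ ∏_w K_wˣ`
as topological groups, `ContinuousMulEquiv.piUnits`, and the product of the identity components is
connected). [cite: NeukirchANT1999, Ch. VI §5 Prop. (5.6)] -/
theorem sq_mem_connectedComponent_one_units_infiniteAdeleRing (x : (InfiniteAdeleRing K)ˣ) :
    x ^ 2 ∈ connectedComponent (1 : (InfiniteAdeleRing K)ˣ) := by
  -- `InfiniteAdeleRing K` is the product `Π w, K_w`; work with the product type
  change (x : (Π w : InfinitePlace K, w.Completion)ˣ) ^ 2 ∈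
    connectedComponent (1 : (Π w : InfinitePlace K, w.Completion)ˣ)
  set y : (Π w : InfinitePlace K, w.Completion)ˣ := x with hy
  let e := (ContinuousMulEquiv.piUnits (M := fun w : InfinitePlace K => w.Completion))
  set S : Set (Π w : InfinitePlace K, (w.Completion)ˣ) :=
    Set.pi Set.univ (fun w => connectedComponent (1 : (w.Completion)ˣ)) with hS
  have hSconn : IsPreconnected S := isPreconnected_univ_pi fun w => isPreconnected_connectedComponent
  have hT : IsPreconnected (e.symm '' S) := hSconn.image _ e.symm.continuous.continuousOn
  have h1 : (1 : (Π w : InfinitePlace K, w.Completion)ˣ) ∈ e.symm '' S :=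
    ⟨1, fun w _ => mem_connectedComponent, map_one _⟩
  have hx : y ^ 2 ∈ e.symm '' S := by
    refine ⟨e (y ^ 2), fun w _ => ?_, e.symm_apply_apply _⟩
    rw [map_pow, Pi.pow_apply]
    exact sq_mem_connectedComponent_one_units_completion w _
  exact (hT.subset_connectedComponent h1) hx

/-! ### §2. Archimedean idèles die under Artin maps of odd order -/

variable (L : IntermediateField K (AlgebraicClosure K)) [FiniteDimensional K L] [IsAbelianGalois K L]
  [NumberField L]

/-- **`ψ_{L|K}` kills every archimedean idèle when `#Gal(L/K)` is odd.**  The Artin symbol of an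
archimedean idèle `u` is `2`-torsion — `u²` lies in the identity component of `K_∞ˣ`, which maps into
the identity component of `C_K`, contained in the norm group `N_{L|K} C_L = ker ψ_{L|K}`
(`connectedComponent_one_subset_normClassGroup`) — and a `2`-torsion element of a group of odd order
is trivial. [cite: NeukirchANT1999, Ch. VI §5 Cor. (5.8)] -/
theorem artinIdeleMap_infiniteIdeles_eq_one_of_odd_card (hodd : Odd (Nat.card (L ≃ₐ[K] L)))
    (u : (InfiniteAdeleRing K)ˣ) :
    artinIdeleMap L artinReciprocity_character_holds (infiniteIdeles K u) = 1 := by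
  set g := artinIdeleMap L artinReciprocity_character_holds (infiniteIdeles K u) with hg
  -- `g ^ 2 = 1`: the square of the archimedean idèle lies in the identity component
  have hsq : g ^ 2 = 1 := by
    rw [hg, ← map_pow, ← map_pow]
    have hconn : (QuotientGroup.mk (infiniteIdeles K (u ^ 2)) : ideleGroup K ⧸ principalIdeles K) ∈
        connectedComponent (1 : ideleGroup K ⧸ principalIdeles K) := by
      have hc : Continuous fun y : (InfiniteAdeleRing K)ˣ =>
          (QuotientGroup.mk (infiniteIdeles K y) : ideleGroup K ⧸ principalIdeles K) :=
        QuotientGroup.continuous_mk.comp (Automorphic.continuous_infiniteIdeles K)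
      have h := hc.image_connectedComponent_subset (1 : (InfiniteAdeleRing K)ˣ)
      rw [map_one, QuotientGroup.mk_one] at h
      exact h ⟨u ^ 2, sq_mem_connectedComponent_one_units_infiniteAdeleRing u, rfl⟩
    have hmem := connectedComponent_one_subset_normClassGroup L hconn
    rw [← ker_artinClassMap_eq L, SetLike.mem_coe, MonoidHom.mem_ker, artinClassMap_mk] at hmem
    exact hmem
  -- `g ^ #Gal(L/K) = 1` with `#Gal(L/K)` odd
  have hcard : g ^ Nat.card (L ≃ₐ[K] L) = 1 := pow_card_eq_one'
  have h2 : orderOf g ∣ 2 := orderOf_dvd_of_pow_eq_one hsq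
  have hG : orderOf g ∣ Nat.card (L ≃ₐ[K] L) := orderOf_dvd_of_pow_eq_one hcard
  have hone : orderOf g = 1 :=
    Nat.eq_one_of_dvd_coprimes (Nat.Coprime.symm ((Nat.coprime_two_left).mpr hodd) |>.symm) h2 hG
  exact orderOf_eq_one_iff.mp hone

omit [NumberField K] [FiniteDimensional K L] [IsAbelianGalois K L] [NumberField L] in
/-- If the cyclic character `ψ : Γ_K ↠ ℤ/d` has kernel `Gal(K̄/L)`, then `#Gal(L/K) = d`
(`Gal(L/K) ≅ Γ_K / Gal(K̄/L) = Γ_K / ker ψ ≅ ℤ/d`). [cite: NeukirchANT1999, Ch. IV §1 Thm. (1.2)] -/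
theorem card_gal_eq_of_ker_eq_galFixing [Normal K L] {d : ℕ} (ψ : CyclicCharacter (absoluteGaloisGroup K) d)
    (hker : ψ.ker = galFixing K L) : Nat.card (L ≃ₐ[K] L) = d := by
  -- `ψ` as a monoid hom to `Multiplicative (ℤ/d)`
  let f : absoluteGaloisGroup K →* Multiplicative (ZMod d) :=
    { toFun := fun σ => Multiplicative.ofAdd (ψ σ)
      map_one' := by rw [ψ.map_one]; rfl
      map_mul' := fun a b => by rw [ψ.map_mul, ofAdd_add] }
  have hfker : f.ker = ψ.ker := by
    ext σ
    rw [MonoidHom.mem_ker, CyclicCharacter.mem_ker]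
    exact ofAdd_eq_one
  have hfsurj : Function.Surjective f := fun y => by
    obtain ⟨σ, hσ⟩ := ψ.surjective (Multiplicative.toAdd y)
    exact ⟨σ, by rw [MonoidHom.coe_mk, OneHom.coe_mk, hσ, ofAdd_toAdd]⟩
  have hf1 : f.ker.index = d := by
    rw [Subgroup.index_ker, MonoidHom.range_eq_top.mpr hfsurj, Subgroup.card_top]
    exact Nat.card_zmod d
  have hf2 : (resGal L).ker.index = Nat.card (L ≃ₐ[K] L) := by
    rw [Subgroup.index_ker, MonoidHom.range_eq_top.mpr (resGal_surjective L), Subgroup.card_top]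
  rw [← hf2, ker_resGal, ← hker, ← hfker, hf1]

/-! ### §3. The sum formula for characters of odd level -/

/-- **`∑_{v ∈ S} inv_v (loc_v (κ_d(b) ∪ ψ)) = 0` for `ψ : Γ_K ↠ ℤ/d` of ODD level `d`, any number
field `K`** (Tate, Cassels–Fröhlich VII §10): the archimedean hypothesis `hinf` of
`sum_localInvariantMap_localization_cupProduct_δ₀_eq_zero` is discharged by
`artinIdeleMap_infiniteIdeles_eq_one_of_odd_card` (`#Gal(L/K) = d` is odd); the remaining hypotheses
are as there: the class vanishes at the finite places where `ψ` ramifies, and `S` contains the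
support of its invariants. [cite: CasselsFrohlichANT1967, Ch. VII §10] -/
theorem sum_localInvariantMap_localization_cupProduct_δ₀_eq_zero_of_odd {d : ℕ} [NeZero d] (hd : Odd d)
    (ψ : CyclicCharacter (absoluteGaloisGroup K) d) (hker : ψ.ker = galFixing K L) (b : Kˣ)
    (hram : ∀ v : HeightOneSpectrum (𝓞 K),
      (∃ σ ∈ absInertia (v.adicCompletion K), ψ (absGaloisRestrict K (v.adicCompletion K) σ) ≠ 0) →
      haveI : CompactSpace (absoluteGaloisGroup K) := absoluteGaloisGroup_compactSpace K
      galoisCohomology.localization (mu K d) (Sum.inr v) 2 (((mu K d).tateDualPairing d).cupProduct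
        ((isSES_kummer K d (NeZero.pos d)).δ₀ (baseUnitsInvariant K (b : K) b.ne_zero))
        (oneCocycleClass _ (scalarCocycle ψ))) = 0)
    (S : Finset (HeightOneSpectrum (𝓞 K)))
    (hS : ∀ v ∉ S,
      haveI : CompactSpace (absoluteGaloisGroup K) := absoluteGaloisGroup_compactSpace K
      localInvariantMap K d v (galoisCohomology.localization (mu K d) (Sum.inr v) 2
        (((mu K d).tateDualPairing d).cupProduct
          ((isSES_kummer K d (NeZero.pos d)).δ₀ (baseUnitsInvariant K (b : K) b.ne_zero))
          (oneCocycleClass _ (scalarCocycle ψ)))) = 0) :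
    haveI : CompactSpace (absoluteGaloisGroup K) := absoluteGaloisGroup_compactSpace K
    ∑ v ∈ S, localInvariantMap K d v (galoisCohomology.localization (mu K d) (Sum.inr v) 2
        (((mu K d).tateDualPairing d).cupProduct
          ((isSES_kummer K d (NeZero.pos d)).δ₀ (baseUnitsInvariant K (b : K) b.ne_zero))
          (oneCocycleClass _ (scalarCocycle ψ)))) = 0 := by
  refine sum_localInvariantMap_localization_cupProduct_δ₀_eq_zero L ψ hker b ?_ hram S hS
  have hcard : Nat.card (L ≃ₐ[K] L) = d := card_gal_eq_of_ker_eq_galFixing L ψ hker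
  exact artinIdeleMap_infiniteIdeles_eq_one_of_odd_card L (hcard ▸ hd) _

end Literature.NumberTheory.GaloisCohomology

end
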